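import Mathlib.Topology.Algebra.OpenSubgroup
import Literature.AnabelianGeometry.SemiGraphs.TemperedReconstruction
import Literature.AnabelianGeometry.SemiGraphs.TemperedMaximalCompact
import HarnessLib

/-!
# Semi-graphs of anabelioids, §3: Corollary 3.9 as a REDUCTION to the steps of its printed proof

Mochizuki, *Semi-graphs of anabelioids*, Publ. RIMS **42** (2006), §3, Corollary 3.9 and its
proof, manuscript pp. 42–43 [cite: MochizukiSemiAnbd2006, Cor 3.9 pp.42-43].  The named fact
`ProfiniteSemiGraph.Cor39` (`TemperedReconstruction.lean`, v2) is derived here from the results its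
printed proof invokes — Theorem 3.7 (i) `VerticialInjective`, (ii) `VerticialDistinct` (typed named
facts of `TemperedVerticial.lean`) — and from NAMED RESIDUAL FACTS typed in this file, one per step
of the printed proof that the tree does not yet hold as a theorem, each quoting its line:

* (R1) `InducesCompatible` — an induced `φ` (Prop. 3.6 (iv): `B^temp(φ) ≅` pull-back along `F`) is
  compatible, up to conjugation, with the verticial and the edge homomorphisms (`Hom.CompatV`,
  `Hom.CompatE` = the v1 rendering of "induced"; announced as a theorem by abc-iut-L3-t10);
* (R0) `InducedIsQuasiGeometric` — p. 42: the quasi-geometricity of an induced morphism "follows by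
  'substituting' the equivalences of Theorem 3.7, (iv), into Definition 3.8";
* (R2) `QuasiGeometricGraphData` — p. 42: "any quasi-geometric `φ` … determines a map from the
  vertices of `G` to the vertices of `H` … Similarly … from the edges of `G` to the edges of `H`
  which is compatible", p. 43 "manifestly … locally open";
* (R3) `InducesOfCompatible` — p. 43: "by varying `G'`, `H'`, we conclude that `φ` arises from a
  morphism of graphs of anabelioids" (the temperoid-level step);
* (R4) `CompatibleEdgeMapUnique` — p. 43 "manifestly unique", edge part.

PROVED glue: `compatible_vertexMap_eq` (two locally open morphisms compatible with the same `φ`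
agree on vertices: the image of a verticial subgroup of `π₁^temp(G)` is open, hence of finite
index, inside verticial subgroups of `π₁^temp(H)` at BOTH image vertices, which Theorem 3.7 (ii)
forbids unless the vertices coincide) and the assembly `corollary_3_9_of_steps`.  Proof-structure
file: no statement of `TemperedReconstruction.lean` is altered (custody abc-iut-L3-d4); nothing here
takes a side on [IUTchIII] Cor. 3.12; typed ≠ discharged (the residuals R0–R4 are open named facts).
-/

open CategoryTheory Topology

namespace Literature.AnabelianGeometry.SemiGraphs

namespace ProfiniteSemiGraph

universe u

variable {𝒢 ℋ : ProfiniteSemiGraph.{u}}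

/-! ### Compatibility of a homomorphism with a morphism, up to conjugation -/

/-- `φ : π₁^temp(G) → π₁^temp(H)` is *compatible with `F : G → H` on verticial homomorphisms*, up to
conjugation: for every vertex `v`, verticial homomorphism `ψ` at `v` and `ψ'` at `F v`,
`φ ∘ ψ = γ_g ∘ ψ' ∘ F_v` for some `g ∈ π₁^temp(H)` (the compatibility a morphism induced "by pulling
back tempered coverings" enjoys, Prop. 3.6 (iv) p. 39; Thm. 3.7 (i)).
[cite: MochizukiSemiAnbd2006, Prop 3.6(iv) p.39] -/
def Hom.CompatV (F : Hom 𝒢 ℋ) (c𝒢 : TemperedPiChart 𝒢) (cℋ : TemperedPiChart ℋ)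
    (φ : c𝒢.G →ₜ* cℋ.G) : Prop :=
  ∀ (v : 𝒢.graph.Vertex) (ψ : 𝒢.Gv v →ₜ* c𝒢.G) (ψ' : ℋ.Gv (F.base.vertexMap v) →ₜ* cℋ.G),
    IsVerticialHom c𝒢 v ψ → IsVerticialHom cℋ (F.base.vertexMap v) ψ' →
      ∃ g : cℋ.G, ∀ x, φ (ψ x) = g * ψ' (F.hV v x) * g⁻¹

/-- The same compatibility on edge homomorphisms (Thm. 3.7 (iii): the edge-like subgroups).
[cite: MochizukiSemiAnbd2006, Prop 3.6(iv) p.39] -/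
def Hom.CompatE (F : Hom 𝒢 ℋ) (c𝒢 : TemperedPiChart 𝒢) (cℋ : TemperedPiChart ℋ)
    (φ : c𝒢.G →ₜ* cℋ.G) : Prop :=
  ∀ (e : 𝒢.graph.Edge) (ψ : 𝒢.Ge e →ₜ* c𝒢.G) (ψ' : ℋ.Ge (F.base.edgeMap e) →ₜ* cℋ.G),
    IsEdgeHom c𝒢 e ψ → IsEdgeHom cℋ (F.base.edgeMap e) ψ' →
      ∃ g : cℋ.G, ∀ x, φ (ψ x) = g * ψ' (F.hE e x) * g⁻¹

/-! ### The named residual facts (steps of the printed proof of Cor. 3.9) -/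

/-- (R1) **An induced homomorphism is compatible with the verticial and edge homomorphisms**
([SemiAnbd] Prop. 3.6 (iv) p. 39, Thm. 3.7 (i) p. 40: `B^temp(φ) ≅ c_H⁻¹ ⋙ F^* ⋙ c_G` restricts,
at each vertex / edge, to an isomorphism `B^temp(φ ∘ ψ_v) ≅ B^temp(ψ_{F v} ∘ F_v)`, whence the two
homomorphisms are conjugate by Prop. 3.2 — announced as `Hom.conj_of_chartPullback_iso` by
abc-iut-L3-t10, not yet in the tree), named residual fact.
[cite: MochizukiSemiAnbd2006, Prop 3.6(iv) p.39] -/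
def InducesCompatible : Prop :=
  ∀ (𝒢 ℋ : ProfiniteSemiGraph.{u}), Cor39Hypotheses 𝒢 → Cor39Hypotheses ℋ →
    ∀ (c𝒢 : TemperedPiChart 𝒢) (cℋ : TemperedPiChart ℋ) (F : Hom 𝒢 ℋ) (φ : c𝒢.G →ₜ* cℋ.G),
      F.Induces c𝒢 cℋ φ → F.CompatV c𝒢 cℋ φ ∧ F.CompatE c𝒢 cℋ φ

/-- (R0) **Corollary 3.9, first step** ([SemiAnbd] p. 42: "any locally open morphism of semi-graphs of
anabelioids `G → H` determines a morphism of temperoids `B^temp(G) → B^temp(H)` [cf. Proposition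
3.6, (iv)] whose quasi-geometricity follows by 'substituting' the equivalences of Theorem 3.7, (iv),
into Definition 3.8"), named residual fact: a homomorphism compatible with a locally open morphism
is quasi-geometric. [cite: MochizukiSemiAnbd2006, Cor 3.9 p.42] -/
def InducedIsQuasiGeometric : Prop :=
  ∀ (𝒢 ℋ : ProfiniteSemiGraph.{u}), Cor39Hypotheses 𝒢 → Cor39Hypotheses ℋ →
    ∀ (c𝒢 : TemperedPiChart 𝒢) (cℋ : TemperedPiChart ℋ) (F : Hom 𝒢 ℋ) (φ : c𝒢.G →ₜ* cℋ.G),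
      F.IsLocallyOpen → F.CompatV c𝒢 cℋ φ → F.CompatE c𝒢 cℋ φ → IsQuasiGeometric φ

/-- (R2) **Corollary 3.9, second step** ([SemiAnbd] p. 42: "by Proposition 3.2; Definition 3.8;
Theorem 3.7, (ii), (iii), any quasi-geometric `φ : B^temp(G) → B^temp(H)` determines a map from the
vertices of `G` to the vertices of `H` — i.e., by considering the unique [conjugacy class of]
verticial subgroup(s) of `π₁^temp(H)` that contain(s) the image of a given verticial subgroup of
`π₁^temp(G)`. Similarly, by considering nontrivial intersections of maximal compact subgroups, one
obtains … a map from the edges of `G` to the edges of `H` which is compatible with the map obtained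
above on vertices"; p. 43 "manifestly … locally open"), named residual fact: a quasi-geometric `φ`
admits a locally open morphism `G → H` with which it is compatible.
[cite: MochizukiSemiAnbd2006, Cor 3.9 pp.42-43] -/
def QuasiGeometricGraphData : Prop :=
  ∀ (𝒢 ℋ : ProfiniteSemiGraph.{u}), Cor39Hypotheses 𝒢 → Cor39Hypotheses ℋ →
    ∀ (c𝒢 : TemperedPiChart 𝒢) (cℋ : TemperedPiChart ℋ) (φ : c𝒢.G →ₜ* cℋ.G),
      IsQuasiGeometric φ →
        ∃ F : Hom 𝒢 ℋ, F.IsLocallyOpen ∧ F.CompatV c𝒢 cℋ φ ∧ F.CompatE c𝒢 cℋ φ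

/-- (R3) **Corollary 3.9, third step** ([SemiAnbd] p. 43: "if `φ` is quasi-geometric, then any
morphism `φ' : B^temp(G') → B^temp(H')` induced by `φ` between étale coverings … is again
quasi-geometric … Thus, we obtain a morphism of graphs `G' → H'`, which is functorial in `G'`, `H'`.
Finally, by varying `G'`, `H'`, we conclude that `φ` arises from a morphism of graphs of
anabelioids"), named residual fact: a homomorphism compatible with a locally open morphism `F` IS
induced by `F` (in the sense `B^temp(φ) ≅` pull-back along `F`, `Hom.Induces`).
[cite: MochizukiSemiAnbd2006, Cor 3.9 p.43] -/
def InducesOfCompatible : Prop :=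
  ∀ (𝒢 ℋ : ProfiniteSemiGraph.{u}), Cor39Hypotheses 𝒢 → Cor39Hypotheses ℋ →
    ∀ (c𝒢 : TemperedPiChart 𝒢) (cℋ : TemperedPiChart ℋ) (F : Hom 𝒢 ℋ) (φ : c𝒢.G →ₜ* cℋ.G),
      F.IsLocallyOpen → F.CompatV c𝒢 cℋ φ → F.CompatE c𝒢 cℋ φ → F.Induces c𝒢 cℋ φ

/-- (R4) **Corollary 3.9, uniqueness on edges** ([SemiAnbd] p. 43: the morphism of graphs of
anabelioids "[again by Theorem 3.7, (iii), (iv)] is manifestly unique"; the vertex part is PROVED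
below, `compatible_vertexMap_eq`), named residual fact: two locally open morphisms compatible with
the same `φ` and agreeing on vertices agree on edges (this uses the total estrangement of `H`:
distinct edges joining the same vertices have non-commensurable edge-like subgroups).
[cite: MochizukiSemiAnbd2006, Cor 3.9 p.43] -/
def CompatibleEdgeMapUnique : Prop :=
  ∀ (𝒢 ℋ : ProfiniteSemiGraph.{u}), Cor39Hypotheses 𝒢 → Cor39Hypotheses ℋ →
    ∀ (c𝒢 : TemperedPiChart 𝒢) (cℋ : TemperedPiChart ℋ) (F F' : Hom 𝒢 ℋ) (φ : c𝒢.G →ₜ* cℋ.G),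
      F.IsLocallyOpen → F'.IsLocallyOpen →
      F.CompatV c𝒢 cℋ φ → F.CompatE c𝒢 cℋ φ → F'.CompatV c𝒢 cℋ φ → F'.CompatE c𝒢 cℋ φ →
        F.base.vertexMap = F'.base.vertexMap → F.base.edgeMap = F'.base.edgeMap

/-! ### Proved glue: uniqueness of the vertex map -/

/-- The hypotheses of Corollary 3.9 contain those of Theorem 3.7. [cite: MochizukiSemiAnbd2006, Cor 3.9 p.42] -/
theorem Cor39Hypotheses.thm37Hypotheses (h : Cor39Hypotheses 𝒢) : 𝒢.Thm37Hypotheses :=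
  ⟨h.toProp36Hypotheses, h.isTotallyEstranged⟩

/-- **Uniqueness of the vertex map** (p. 43 "manifestly unique", vertex part, PROVED from
Theorem 3.7 (i), (ii)): if two locally open morphisms `F, F' : G → H` are both compatible with
`φ` on verticial homomorphisms, they agree on vertices.  For `v` a vertex, `φ(ψ_v(Π_v))` lies in a
verticial subgroup `W₁` at `F v` and in a verticial subgroup `W₂` at `F' v`; inside `W₁` it is the
image of the OPEN subgroup `F_v(Π_v) ⊆ Π_{F v}` under the injective `γ_g ∘ ψ_{F v}`, so it has
finite index in `W₁`; hence `[W₁ : W₁ ∩ W₂] < ∞`, which by Thm. 3.7 (ii) forces `F v = F' v`.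
[cite: MochizukiSemiAnbd2006, Cor 3.9 p.43] -/
theorem compatible_vertexMap_eq (h37i : VerticialInjective.{u}) (h37ii : VerticialDistinct.{u})
    (h𝒢 : Cor39Hypotheses 𝒢) (hℋ : Cor39Hypotheses ℋ) (c𝒢 : TemperedPiChart 𝒢)
    (cℋ : TemperedPiChart ℋ) {F F' : Hom 𝒢 ℋ} {φ : c𝒢.G →ₜ* cℋ.G} (hF : F.IsLocallyOpen)
    (hV : F.CompatV c𝒢 cℋ φ) (hV' : F'.CompatV c𝒢 cℋ φ) :
    F.base.vertexMap = F'.base.vertexMap := by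
  funext v
  -- verticial homomorphisms at `v`, `F v`, `F' v`
  obtain ⟨⟨_, ψ, ⟨eψ⟩, rfl⟩, -⟩ := h37i 𝒢 h𝒢.thm37Hypotheses c𝒢 v
  obtain ⟨⟨_, ψ₁, ⟨e₁⟩, rfl⟩, hinj₁⟩ := h37i ℋ hℋ.thm37Hypotheses cℋ (F.base.vertexMap v)
  obtain ⟨⟨_, ψ₂, ⟨e₂⟩, rfl⟩, -⟩ := h37i ℋ hℋ.thm37Hypotheses cℋ (F'.base.vertexMap v)
  obtain ⟨g₁, hg₁⟩ := hV v ψ ψ₁ ⟨eψ⟩ ⟨e₁⟩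
  obtain ⟨g₂, hg₂⟩ := hV' v ψ ψ₂ ⟨eψ⟩ ⟨e₂⟩
  -- the three subgroups of `π₁^temp(H)`
  let S : Subgroup cℋ.G := ψ.toMonoidHom.range.map φ.toMonoidHom
  let W₁ : Subgroup cℋ.G := ψ₁.toMonoidHom.range.map (MulAut.conj g₁).toMonoidHom
  let W₂ : Subgroup cℋ.G := ψ₂.toMonoidHom.range.map (MulAut.conj g₂).toMonoidHom
  have hW₁ : W₁ ∈ verticialSubgroups cℋ (F.base.vertexMap v) :=
    conj_mem_verticialSubgroups cℋ ⟨ψ₁, ⟨e₁⟩, rfl⟩ g₁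
  have hW₂ : W₂ ∈ verticialSubgroups cℋ (F'.base.vertexMap v) :=
    conj_mem_verticialSubgroups cℋ ⟨ψ₂, ⟨e₂⟩, rfl⟩ g₂
  have hSW₂ : S ≤ W₂ := by
    rintro _ ⟨_, ⟨x, rfl⟩, rfl⟩
    refine ⟨ψ₂ (F'.hV v x), ⟨F'.hV v x, rfl⟩, ?_⟩
    change g₂ * ψ₂ (F'.hV v x) * g₂⁻¹ = φ (ψ x)
    exact (hg₂ x).symm
  -- `S` and `W₁` through the injective `j = γ_{g₁} ∘ ψ₁`
  let j : ℋ.Gv (F.base.vertexMap v) →* cℋ.G :=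
    (MulAut.conj g₁).toMonoidHom.comp ψ₁.toMonoidHom
  have hj : Function.Injective j := fun a b h =>
    hinj₁ ψ₁ ⟨e₁⟩ ((MulAut.conj g₁).injective h)
  let U : Subgroup (ℋ.Gv (F.base.vertexMap v)) := (F.hV v).toMonoidHom.range
  have hS : S = U.map j := by
    ext y
    constructor
    · rintro ⟨_, ⟨x, rfl⟩, rfl⟩
      exact ⟨F.hV v x, ⟨x, rfl⟩, (hg₁ x).symm⟩
    · rintro ⟨_, ⟨x, rfl⟩, rfl⟩
      exact ⟨ψ x, ⟨x, rfl⟩, hg₁ x⟩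
  have hW₁j : W₁ = (⊤ : Subgroup (ℋ.Gv (F.base.vertexMap v))).map j := by
    change (Subgroup.map _ _) = _
    rw [MonoidHom.range_eq_map, Subgroup.map_map]
  -- `S` has finite index in `W₁`: `U` is open in the profinite `Π_{F v}`
  have hU : U.index ≠ 0 := by
    haveI := Subgroup.quotient_finite_of_isOpen U (hF.1 v)
    exact Subgroup.index_ne_zero_of_finite
  have hSW₁ : S.relIndex W₁ ≠ 0 := by
    rw [hS, hW₁j, Subgroup.relIndex_map_map_of_injective _ _ hj, Subgroup.relIndex_top_right]
    exact hU
  have hW₂W₁ : W₂.relIndex W₁ ≠ 0 := fun h0 => hSW₁ (Subgroup.relIndex_eq_zero_of_le_left hSW₂ h0)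
  -- Theorem 3.7 (ii), clause 1
  by_contra hne
  exact hW₂W₁ ((h37ii ℋ hℋ.thm37Hypotheses cℋ).1 _ _ W₁ W₂ hW₁ hW₂ hne)

/-! ### Corollary 3.9 from the steps of its proof -/

/-- **[SemiAnbd] Cor. 3.9 from the steps of its printed proof** (pp. 42–43): (a) an induced
homomorphism is compatible (R1) hence quasi-geometric (R0); (b) a quasi-geometric `φ` admits a
compatible locally open `F` (R2), which induces it (R3); and any locally open `F'` inducing `φ` is
compatible (R1), so agrees with `F` on vertices (`compatible_vertexMap_eq`, from Thm. 3.7 (i), (ii))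
and on edges (R4). [cite: MochizukiSemiAnbd2006, Cor 3.9 pp.42-43] -/
theorem corollary_3_9_of_steps (h37i : VerticialInjective.{u}) (h37ii : VerticialDistinct.{u})
    (hR1 : InducesCompatible.{u}) (hR0 : InducedIsQuasiGeometric.{u})
    (hR2 : QuasiGeometricGraphData.{u}) (hR3 : InducesOfCompatible.{u})
    (hR4 : CompatibleEdgeMapUnique.{u}) : Cor39.{u} := by
  intro 𝒢 ℋ h𝒢 hℋ c𝒢 cℋ
  refine ⟨fun F hF φ hind => ?_, fun φ hφ => ?_⟩
  · obtain ⟨hV, hE⟩ := hR1 𝒢 ℋ h𝒢 hℋ c𝒢 cℋ F φ hind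
    exact hR0 𝒢 ℋ h𝒢 hℋ c𝒢 cℋ F φ hF hV hE
  · obtain ⟨F, hF, hV, hE⟩ := hR2 𝒢 ℋ h𝒢 hℋ c𝒢 cℋ φ hφ
    refine ⟨F, hF, hR3 𝒢 ℋ h𝒢 hℋ c𝒢 cℋ F φ hF hV hE, fun F' hF' hind' => ?_⟩
    obtain ⟨hV', hE'⟩ := hR1 𝒢 ℋ h𝒢 hℋ c𝒢 cℋ F' φ hind'
    have hv : F'.base.vertexMap = F.base.vertexMap :=
      compatible_vertexMap_eq h37i h37ii h𝒢 hℋ c𝒢 cℋ hF' hV' hV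
    exact ⟨hv, hR4 𝒢 ℋ h𝒢 hℋ c𝒢 cℋ F' F φ hF' hF hV' hE' hV hE hv⟩

end ProfiniteSemiGraph

end Literature.AnabelianGeometry.SemiGraphs
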